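import Summits.BirchSwinnertonDyer.Rank1Residual.Additive.PotSupersingularTargets
import Summits.BirchSwinnertonDyer.Rank1Residual.Additive.QuadraticBranchOddStrictExactControlDischarge
import Summits.BirchSwinnertonDyer.Rank1Residual.Additive.QuadraticBranchEvenExactControl
import Summits.BirchSwinnertonDyer.Rank1Residual.Additive.QuadraticBranchMinusLeadingValuation
import Summits.BirchSwinnertonDyer.Rank1Residual.O6.X3KatoMemberBoundReadings
import HarnessLib

/-!
# Rung K8/K9 node bundle for the route files of cell bsd-potss (D-0059/D-0061)

Route files (`Summits/BirchSwinnertonDyer/BirchSwinnertonDyer/Theses/*.lean`) may import only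
`Mathlib/Std/Batteries/Literature/HarnessLib`, `Summits.<P>.Statement` and `Summits.<P>.Theorems.*`.
The typed conjecture nodes of the additive potentially-supersingular classes (rung K8 = leaf
`Additive.O5SharpGss`, rung K9 = leaves `Additive.O6Sharp` + `Additive.O5SharpTprime`) live under
`Summits/BirchSwinnertonDyer/Rank1Residual/Additive/`; this module re-exports them into the
`Theorems.*` cone so that the routes `QuadraticBranchSignedControl` (K8) and `KatoDescentPotSupersingular` (K9)
can state their cruxes as ∀-closures of the existing nodes, and records the one piece of pure-logic
bookkeeping the K8 deciding theorem uses: the split of the Gss2 leaf into its `p = 3` and `p ≥ 5` rows.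
(Director D-0059 ROUTE MECHANICS 2026-08-25T19:23Z: the Theorems-side bridge pattern.)
Nothing is asserted; no definition and no new conjecture node is introduced (two bookkeeping `↔`).
-/

open WeierstrassCurve
open Literature.NumberTheory.EllipticCurves
open Literature.NumberTheory.EllipticCurves.Rank1Residual
open Literature.NumberTheory.EllipticCurves.Rank1Residual.Typed

namespace Summit.BirchSwinnertonDyer.Rank1Residual.Additive

/-- Pure-logic split of the rung-K8 leaf: `O5SharpGss` (odd `p`) is exactly its `p = 3` rows
together with its `p ≥ 5` rows (`Nat.Prime.five_le_of_ne_two_of_ne_three`); the route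
`QuadraticBranchSignedControl` proves the first from its declared residual and the second from its
assembly. Bookkeeping only. [folklore] -/
theorem o5SharpGss_iff_atThree_and_geFive :
    O5SharpGss ↔
      (∀ (W : WeierstrassCurve ℚ) [W.IsElliptic] [W.IsGloballyMinimal] [Fact (3 : ℕ).Prime],
          W.analyticRank ≤ 1 → Addv W 3 → SubGss W 3 → MissingPPartAt W 3) ∧
      (∀ (W : WeierstrassCurve ℚ) [W.IsElliptic] [W.IsGloballyMinimal] (p : ℕ) [Fact p.Prime],
          W.analyticRank ≤ 1 → 5 ≤ p → Addv W p → SubGss W p → MissingPPartAt W p) := by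
  constructor
  · intro h
    refine ⟨fun W _ _ _ hr hadd hG => h W 3 hr (by decide) hadd hG,
      fun W _ _ p _ hr hp hadd hG => h W p hr (by omega) hadd hG⟩
  · rintro ⟨h3, h5⟩ W _ _ p hp hr hp2 hadd hG
    by_cases hp3 : p = 3
    · subst hp3
      exact h3 W hr hadd hG
    · exact h5 W p hr (hp.out.five_le_of_ne_two_of_ne_three hp2 hp3) hadd hG

/-- Pure-logic split of the rung-K9 wild leaf: `O6Sharp` is its rank-0 rows together with its rank-1
rows at `p = 3` (`ClassO6.p_eq_three`); the route `KatoDescentPotSupersingular` proves the first from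
its cruxes and declares the second residual. Bookkeeping only. [folklore] -/
theorem o6Sharp_iff_rankZero_and_rankOne_three :
    O6Sharp ↔
      (∀ (W : WeierstrassCurve ℚ) [W.IsElliptic] [W.IsGloballyMinimal] [Fact (3 : ℕ).Prime],
          W.analyticRank = 0 → ClassO6 W 3 → MissingPPartAt W 3) ∧
      (∀ (W : WeierstrassCurve ℚ) [W.IsElliptic] [W.IsGloballyMinimal] [Fact (3 : ℕ).Prime],
          W.analyticRank = 1 → ClassO6 W 3 → MissingPPartAt W 3) := by
  constructor
  · intro h
    exact ⟨fun W _ _ _ hr hO => h W 3 (by omega) hO, fun W _ _ _ hr hO => h W 3 (by omega) hO⟩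
  · rintro ⟨h0, h1⟩ W _ _ p hp hr hO
    obtain rfl : p = 3 := ClassO6.p_eq_three (W := W) (p := p) hO
    rcases Nat.le_one_iff_eq_zero_or_eq_one.mp hr with h | h
    · exact h0 W h hO
    · exact h1 W h hO

end Summit.BirchSwinnertonDyer.Rank1Residual.Additive
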